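/-
Copyright: the b2b-balaban cell (near-miss cell 7), T⁴-continuum fan-out, NE7b ROUND-2 swarm `t4-ne7b-formalise-*`
(seat leaf-10, gen 4), supplier module for row S6g′-INSTANCE piece T3c «lattice-animal factor» (owner's ruling
R-OWNER-22-23) of lineage t4-ne7b-p1's claim table `LEAVES-NE7b.md`.
Released under the licence of the surrounding project.
-/
import Summits.QuantumFields.BalabanUV.T4Continuum.Support.HistoryJoins

/-!
# Birth menus: products over the births of a genealogy, and the address bridge

Summits-side support leaf of the T⁴-continuum cell (rung (B)+1 on a FINITE torus only; NOT infinite volume, NOT the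
mass gap, NOT the Clay statement; NOT a proof of the spine estimate NE7b).  Row S6g′-INSTANCE, piece T3c of the
owner's ruling R-OWNER-22-23, GENERIC half (the ℤ^d template count is the sibling module `HistoryRegionTemplates`):
when every birth of fatness `f` chooses from a finite MENU `T f` with `#(T f) ≤ exp(θ·(f+1))`, the choices for a
whole genealogy number `∏_{births, with multiplicity} #(T (fat b)) ≤ exp(θ·bsum (fat+1) G)` — class-linear in the
exits' letter `bsum (1+fat)` (`HistoryJoins.bsum`).  [folklore] finite tree bookkeeping over the swarm's OWN carrier
(`T4PersistenceDictionary.Gen`, `HistoryJoins.{bsum, baddr}`); Mathlib + `HistoryJoins` only; nothing is quoted from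
print, nothing printed is asserted, no `[cite:]` tag, no `Prop` fact minted, no constants.

WHAT.
* §1 **`labAt G l`**: the birth label at address `l` (`false` = first partner, `true` = second, renewals transparent —
  the convention of `HistoryJoins.baddr`), `none` off the birth addresses; **`isSome_labAt_iff : … ↔ l ∈ baddr G`**;
  **`bsum_eq_sum_baddr`**: `bsum f G = Σ_{l ∈ baddr G} f(label at l)` (no separation hypothesis: addresses never
  collide, unlike labels of a flat genealogy).
* §2 **`mprod T fat G`** = `∏_{births, with multiplicity} #(T (fat b))`; `one_le_mprod`, `mprod_relabel`,
  **`mprod_le_exp_bsum`** (from the per-menu bound), **`mprod_eq_prod_baddr`**, **`card_pi_baddr_eq_mprod`** (the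
  finset `(baddr G).pi (l ↦ T (fat at l))` of menu assignments has exactly `mprod` members) and, for TOTAL assignments
  on any finite address type (e.g. `HistoryJoinsAdm.Addr D`, `val = Subtype.val`) with the junk convention «one
  choice off the birth addresses», **`card_piFinset_le_mprod`** ∕ **`card_piFinset_le_exp_bsum`** — whatever the depth
  cut-off (birth addresses missing from the type only drop factors `≥ 1`).

HONEST DEPENDENCY (cell, verbatim): continuum YM on T⁴ ⇐ BetaPertH ∧ nine spine estimates (0/9 proved); BetaPertH ⇐
(D1) ∧ (D4) ∧ CAP+tail; G-an2-4 gates asym, D1 and NE2/3/4.  This file changes none of it; NE7b NOT proved.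
-/

open Finset
open Literature.MathematicalPhysics.QuantumFieldTheory.Balaban1983to89
open T4PersistenceDictionary T4BranchingRecordsGas
open Summit.QuantumFields.BalabanUV.T4Continuum.HistoryJoins

namespace Summit.QuantumFields.BalabanUV.T4Continuum.HistoryBirthMenus

noncomputable section

variable {ε : Type*}

/-! ## §1 The birth label at an address -/

/-- **THE BIRTH LABEL AT AN ADDRESS** (`false` = first partner, `true` = second; renewals transparent), `none` off the
birth addresses. [folklore] -/
def labAt : Gen ε → List Bool → Option ε
  | Gen.born b _, [] => some b
  | Gen.born _ _, _ :: _ => none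
  | Gen.renew G _ _, l => labAt G l
  | Gen.merge _ _ _, [] => none
  | Gen.merge X _ _, false :: l => labAt X l
  | Gen.merge _ Y _, true :: l => labAt Y l

/-- label at the empty address of a birth [folklore] -/
@[simp] theorem labAt_born_nil (b : ε) (j : ℕ) : labAt (Gen.born b j) [] = some b := rfl
/-- no label below a birth [folklore] -/
@[simp] theorem labAt_born_cons (b : ε) (j : ℕ) (s : Bool) (l : List Bool) :
    labAt (Gen.born b j) (s :: l) = none := rfl
/-- renewals are transparent [folklore] -/
@[simp] theorem labAt_renew (G : Gen ε) (e : ε) (h : ℕ) (l : List Bool) :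
    labAt (Gen.renew G e h) l = labAt G l := rfl
/-- a merger node carries no birth [folklore] -/
@[simp] theorem labAt_merge_nil (X Y : Gen ε) (e : ε) : labAt (Gen.merge X Y e) [] = none := rfl
/-- first partner [folklore] -/
@[simp] theorem labAt_merge_false (X Y : Gen ε) (e : ε) (l : List Bool) :
    labAt (Gen.merge X Y e) (false :: l) = labAt X l := rfl
/-- second partner [folklore] -/
@[simp] theorem labAt_merge_true (X Y : Gen ε) (e : ε) (l : List Bool) :
    labAt (Gen.merge X Y e) (true :: l) = labAt Y l := rfl

/-- **THE BIRTH ADDRESSES ARE EXACTLY WHERE A LABEL SITS.** [folklore] -/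
theorem isSome_labAt_iff : ∀ (G : Gen ε) (l : List Bool), (labAt G l).isSome ↔ l ∈ baddr G
  | Gen.born b _, [] => by simp [baddr]
  | Gen.born _ _, _ :: _ => by simp [baddr]
  | Gen.renew G _ _, l => by rw [labAt_renew, baddr]; exact isSome_labAt_iff G l
  | Gen.merge _ _ _, [] => by simp [baddr]
  | Gen.merge X _ _, false :: l => by
      rw [labAt_merge_false, isSome_labAt_iff X l]
      simp [baddr]
  | Gen.merge _ Y _, true :: l => by
      rw [labAt_merge_true, isSome_labAt_iff Y l]
      simp [baddr]

/-- at a birth address the label is `some` [folklore] -/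
theorem exists_labAt_eq_some {G : Gen ε} {l : List Bool} (hl : l ∈ baddr G) : ∃ b, labAt G l = some b :=
  Option.isSome_iff_exists.1 ((isSome_labAt_iff G l).2 hl)

/-- the two partners' address blocks are disjoint [folklore] -/
theorem disjoint_baddr_images (X Y : Gen ε) :
    Disjoint ((baddr X).image (List.cons false)) ((baddr Y).image (List.cons true)) := by
  rw [disjoint_left]
  intro l hl hl'
  obtain ⟨a, -, rfl⟩ := mem_image.1 hl
  obtain ⟨b, -, hb⟩ := mem_image.1 hl'
  simp at hb

/-- **THE BIRTH SUM IS THE SUM OVER THE ADDRESSES** of the values at the labels found there (no separation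
hypothesis). [folklore] -/
theorem bsum_eq_sum_baddr (f : ε → ℝ) : ∀ G : Gen ε, bsum f G = ∑ l ∈ baddr G, (labAt G l).elim 0 f
  | Gen.born b _ => by simp [bsum, baddr]
  | Gen.renew G _ _ => by
      rw [bsum, baddr, bsum_eq_sum_baddr f G]
      rfl
  | Gen.merge X Y _ => by
      rw [bsum, baddr, sum_union (disjoint_baddr_images X Y),
        sum_image fun a _ b _ h => List.cons_injective h, sum_image fun a _ b _ h => List.cons_injective h,
        bsum_eq_sum_baddr f X, bsum_eq_sum_baddr f Y]
      rfl

/-! ## §2 Menu products over the births -/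

section Menus

variable {α : Type*} (T : ℕ → Finset α)

/-- **MENU ASSIGNMENTS OF A GENEALOGY, COUNTED**: `∏_{births, with multiplicity} #(T (fat b))` — the multiplicative
companion of `HistoryJoins.bsum`. [folklore] -/
def mprod (fat : ε → ℕ) : Gen ε → ℕ
  | Gen.born b _ => (T (fat b)).card
  | Gen.renew G _ _ => mprod fat G
  | Gen.merge X Y _ => mprod fat X * mprod fat Y

/-- `mprod` of a birth [folklore] -/
@[simp] theorem mprod_born (fat : ε → ℕ) (b : ε) (j : ℕ) : mprod T fat (Gen.born b j) = (T (fat b)).card := rfl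
/-- `mprod` of a renewal [folklore] -/
@[simp] theorem mprod_renew (fat : ε → ℕ) (G : Gen ε) (e : ε) (h : ℕ) :
    mprod T fat (Gen.renew G e h) = mprod T fat G := rfl
/-- `mprod` of a merger [folklore] -/
@[simp] theorem mprod_merge (fat : ε → ℕ) (X Y : Gen ε) (e : ε) :
    mprod T fat (Gen.merge X Y e) = mprod T fat X * mprod T fat Y := rfl

/-- `mprod` through a relabelling [folklore] -/
theorem mprod_relabel {δ : Type*} (g : ε → δ) (fat : δ → ℕ) :
    ∀ G : Gen ε, mprod T fat (relabel g G) = mprod T (fat ∘ g) G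
  | Gen.born _ _ => rfl
  | Gen.renew G _ _ => mprod_relabel g fat G
  | Gen.merge X Y _ => by simp only [relabel_merge, mprod, mprod_relabel g fat X, mprod_relabel g fat Y]

/-- `1 ≤ mprod` when no menu is empty [folklore] -/
theorem one_le_mprod (h1 : ∀ f, 1 ≤ (T f).card) (fat : ε → ℕ) : ∀ G : Gen ε, 1 ≤ mprod T fat G
  | Gen.born b _ => h1 (fat b)
  | Gen.renew G _ _ => one_le_mprod h1 fat G
  | Gen.merge X Y _ => Nat.one_le_iff_ne_zero.2
      (Nat.mul_ne_zero (Nat.one_le_iff_ne_zero.1 (one_le_mprod h1 fat X))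
        (Nat.one_le_iff_ne_zero.1 (one_le_mprod h1 fat Y)))

/-- **THE MENU PRODUCT IN THE EXITS' CURRENCY**: if every menu obeys `#(T f) ≤ exp(θ·(f+1))` then
`mprod T fat G ≤ exp(θ · bsum (fun b ↦ fat b + 1) G)`. [folklore] -/
theorem mprod_le_exp_bsum {θ : ℝ} (hT : ∀ f : ℕ, ((T f).card : ℝ) ≤ Real.exp (θ * ((f : ℝ) + 1))) (fat : ε → ℕ) :
    ∀ G : Gen ε, (mprod T fat G : ℝ) ≤ Real.exp (θ * bsum (fun b => (fat b : ℝ) + 1) G)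
  | Gen.born b _ => hT (fat b)
  | Gen.renew G _ _ => mprod_le_exp_bsum hT fat G
  | Gen.merge X Y _ => by
      rw [mprod_merge, Nat.cast_mul, bsum, mul_add, Real.exp_add]
      exact mul_le_mul (mprod_le_exp_bsum hT fat X) (mprod_le_exp_bsum hT fat Y) (by positivity) (by positivity)

/-- **THE MENU PRODUCT IS THE PRODUCT OVER THE ADDRESSES.** [folklore] -/
theorem mprod_eq_prod_baddr (fat : ε → ℕ) :
    ∀ G : Gen ε, mprod T fat G = ∏ l ∈ baddr G, (T ((labAt G l).elim 0 fat)).card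
  | Gen.born b _ => by simp [baddr]
  | Gen.renew G _ _ => by
      rw [mprod_renew, baddr, mprod_eq_prod_baddr fat G]
      rfl
  | Gen.merge X Y _ => by
      rw [mprod_merge, baddr, prod_union (disjoint_baddr_images X Y),
        prod_image fun a _ b _ h => List.cons_injective h, prod_image fun a _ b _ h => List.cons_injective h,
        mprod_eq_prod_baddr fat X, mprod_eq_prod_baddr fat Y]
      rfl

/-- **ASSIGNMENTS INDEXED BY THE BIRTH ADDRESSES NUMBER `mprod`**: the finset `(baddr G).pi (l ↦ T (fat at l))`
has exactly `mprod T fat G` members. [folklore] -/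
theorem card_pi_baddr_eq_mprod (fat : ε → ℕ) (G : Gen ε) :
    ((baddr G).pi fun l => T ((labAt G l).elim 0 fat)).card = mprod T fat G := by
  rw [Finset.card_pi, mprod_eq_prod_baddr]

/-- … hence at most `exp(θ · bsum (fat+1) G)` of them [folklore] -/
theorem card_pi_baddr_le_exp_bsum {θ : ℝ} (hT : ∀ f : ℕ, ((T f).card : ℝ) ≤ Real.exp (θ * ((f : ℝ) + 1)))
    (fat : ε → ℕ) (G : Gen ε) :
    ((((baddr G).pi fun l => T ((labAt G l).elim 0 fat)).card : ℕ) : ℝ)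
      ≤ Real.exp (θ * bsum (fun b => (fat b : ℝ) + 1) G) := by
  rw [card_pi_baddr_eq_mprod]
  exact mprod_le_exp_bsum T hT fat G

/-- **TOTAL ASSIGNMENTS ON A FINITE ADDRESS TYPE** (e.g. `HistoryJoinsAdm.Addr D`, `val = Subtype.val`): if the
factor at every address carrying a birth of `G` is that birth's menu and every other factor has at most one member
(junk convention), the assignments number at most `mprod T fat G` — whatever the depth cut-off: birth addresses of `G`
missing from `A` only drop factors `≥ 1`. [folklore] -/
theorem card_piFinset_le_mprod (h1 : ∀ f, 1 ≤ (T f).card) {A : Type*} [Fintype A] [DecidableEq A]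
    (val : A → List Bool) (hval : Function.Injective val) (fat : ε → ℕ) (G : Gen ε) (t : A → Finset α)
    (ht : ∀ a, val a ∈ baddr G → t a = T ((labAt G (val a)).elim 0 fat))
    (ht' : ∀ a, val a ∉ baddr G → (t a).card ≤ 1) :
    (Fintype.piFinset t).card ≤ mprod T fat G := by
  classical
  rw [Fintype.card_piFinset, mprod_eq_prod_baddr,
    ← prod_filter_mul_prod_filter_not univ (fun a => val a ∈ baddr G)]
  have hA : ∏ a ∈ univ.filter (fun a => val a ∉ baddr G), (t a).card ≤ 1 :=
    prod_le_one' fun a ha => ht' a (mem_filter.1 ha).2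
  have hB : ∏ a ∈ univ.filter (fun a => val a ∈ baddr G), (t a).card
      = ∏ l ∈ (univ.filter (fun a => val a ∈ baddr G)).image val, (T ((labAt G l).elim 0 fat)).card := by
    rw [prod_image fun a _ b _ h => hval h]
    exact prod_congr rfl fun a ha => by rw [ht a (mem_filter.1 ha).2]
  have hC : (univ.filter (fun a => val a ∈ baddr G)).image val ⊆ baddr G := by
    intro l hl
    obtain ⟨a, ha, rfl⟩ := mem_image.1 hl
    exact (mem_filter.1 ha).2
  calc (∏ a ∈ univ.filter (fun a => val a ∈ baddr G), (t a).card)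
        * ∏ a ∈ univ.filter (fun a => val a ∉ baddr G), (t a).card
      ≤ (∏ a ∈ univ.filter (fun a => val a ∈ baddr G), (t a).card) * 1 := Nat.mul_le_mul_left _ hA
    _ = ∏ l ∈ (univ.filter (fun a => val a ∈ baddr G)).image val, (T ((labAt G l).elim 0 fat)).card := by
        rw [mul_one, hB]
    _ ≤ ∏ l ∈ baddr G, (T ((labAt G l).elim 0 fat)).card :=
        prod_le_prod_of_subset_of_one_le' hC fun l _ _ => h1 _

/-- … and hence at most `exp(θ · bsum (fat+1) G)` [folklore] -/
theorem card_piFinset_le_exp_bsum (h1 : ∀ f, 1 ≤ (T f).card) {θ : ℝ}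
    (hT : ∀ f : ℕ, ((T f).card : ℝ) ≤ Real.exp (θ * ((f : ℝ) + 1))) {A : Type*} [Fintype A] [DecidableEq A]
    (val : A → List Bool) (hval : Function.Injective val) (fat : ε → ℕ) (G : Gen ε) (t : A → Finset α)
    (ht : ∀ a, val a ∈ baddr G → t a = T ((labAt G (val a)).elim 0 fat))
    (ht' : ∀ a, val a ∉ baddr G → (t a).card ≤ 1) :
    ((Fintype.piFinset t).card : ℝ) ≤ Real.exp (θ * bsum (fun b => (fat b : ℝ) + 1) G) :=
  (Nat.cast_le.2 (card_piFinset_le_mprod T h1 val hval fat G t ht ht')).trans (mprod_le_exp_bsum T hT fat G)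

end Menus

/-! ## §3 Sanity (decided ∕ definitional toy instances) -/

namespace Sanity

/-- a toy genealogy: two births merged, then renewed -/
def GT : Gen ℕ := Gen.renew (Gen.merge (Gen.born 2 0) (Gen.born 0 1) 7) 8 1

/-- its birth addresses are `[false]` and `[true]` -/
example : baddr GT = {[false], [true]} := by decide

/-- the label at address `[true]` is the second birth `0`; the top address carries no birth -/
example : labAt GT [true] = some 0 ∧ labAt GT [] = none := ⟨rfl, rfl⟩

/-- with the menu `T f = range (f+1)` and fatness read by `id`, `mprod` multiplies `#range 3` and `#range 1` -/
example : mprod (fun f => range (f + 1)) id GT = 3 * 1 := by simp [GT]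

end Sanity

end

end Summit.QuantumFields.BalabanUV.T4Continuum.HistoryBirthMenus
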